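import Literature.LinearAlgebra.Alternating.WedgeWordsBasis
import Literature.Geometry.Kaehler.ComplexTorusCoordForms
import Literature.Geometry.Kaehler.ComplexTorusHodge
import Literature.Geometry.Kaehler.ManifoldFormsPullback
import Literature.NumberTheory.Transcendental.DeRhamTheorem
import Mathlib.Tactic.Module
import HarnessLib

/-!
# Lattice monomials `dx_{i₁} ∧ ⋯ ∧ dx_{i_k}` of a complex torus and the action of homomorphisms

Companion of `Literature/Geometry/Kaehler/ComplexTorusCoordForms.lean` (lattice coordinates
`xₐ = eₐ* ∘ Φ⁻¹`, the `k = 2` coordinate forms and `coord_realRep`: `xₐ ∘ ρ(A) = Σ_c A_{ac} x_c`)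
and of `Literature/LinearAlgebra/Alternating/WedgeWordsBasis.lean` (increasing monomials of a dual
frame form a basis). For the complex torus `X = E/Φ(ℤ^ι)`:

* `latMonomial Φ k w = dx_{w 0} ∧ ⋯ ∧ dx_{w (k-1)} ∧ 1 ∈ Alt^k_ℝ(E; ℂ)` (the `frameWord` of the
  lattice coordinate frame), and for linearly ordered `ι` the basis `latMonomialBasis Φ k` of the
  increasing ones — Lange–Birkenhake (1992), Prop. 1.1.20: "the classes of the `n`-forms
  `dx_{i₁} ∧ ⋯ ∧ dx_{iₙ}`, `i₁ < ⋯ < iₙ`, form a basis of `Hⁿ(X, ℂ)`" (pointwise; the classes by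
  `ComplexTorus.cconstClassEquiv`);
* `wedgeWord_compContinuousLinearMap`: pull-back of monomials, `T^*(θ_w ∧ c) = (T^*θ)_w ∧ T^*c`;
* `latMonomial_comp_realRep`: **homomorphisms act on the lattice monomials by `⋀ᵏ` of the rational
  representation**: `dx_w ∘ ρ(A) = Σ_u (∏ᵢ A_{w i, u i}) dx_u` over all words `u`, for every integer
  matrix `A` (Lange–Birkenhake (1992), §1.1.2, `ρᵣ`, with Lemma 1.1.17 / Ex. 1.1.6 (7):
  `Hᵏ = ⋀ᵏ Hom(Λ, ℤ)` functorially), hence `latMonomial_comp_realRep_mem_span`: the `ℤ`-span (so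
  the `ℚ`-span) of the lattice monomials is stable under every `ρ(A)` — the rational structure;
* `cmap_cconstClass_mapMatrix`: on classes, `(mapMatrix A)^*[c] = [c ∘ ρ(A)]` in `H^k_dR(X; ℂ)`
  (complex-coefficient form of `ComplexTorus.map_constClass_mapMatrix`).

## References

* H. Lange, Ch. Birkenhake, *Complex Abelian Varieties* (1992), §1.1.2 (rational and analytic
  representations), §1.1.3 Lemma 1.1.17, §1.1.4 Prop. 1.1.20. [LangeBirkenhake1992]
-/

noncomputable section

open scoped Manifold ContDiff
open ContinuousAlternatingMap Function
open Literature.LinearAlgebra.Alternating Literature.NumberTheory.Transcendental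

namespace Literature.LinearAlgebra.Alternating

/-! ### Pull-back of monomials by linear maps -/

section Pullback

variable {𝕜' : Type*} [NormedField 𝕜'] [NormedAlgebra ℝ 𝕜'] {V W : Type*} [NormedAddCommGroup V]
  [NormedSpace ℝ V] [NormedAddCommGroup W] [NormedSpace ℝ W] {F : Type*} [NormedAddCommGroup F]
  [NormedSpace ℝ F] [NormedSpace 𝕜' F] [IsScalarTower ℝ 𝕜' F]

/-- Pull-back of a wedge with a covector: `T^*(θ ∧ η) = T^*θ ∧ T^*η` (Warner (1983), 2.22; the
same computation as `Literature.NumberTheory.Transcendental.wedgeOne_compContinuousLinearMap`,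
restated here to keep the import light). [cite: Warner1983, 2.22] -/
theorem wedgeOne_compContinuousLinearMap' {n : ℕ} (θ : V →L[ℝ] 𝕜') (η : V [⋀^Fin n]→L[ℝ] F)
    (T : W →L[ℝ] V) :
    (wedgeOne θ η).compContinuousLinearMap T = wedgeOne (θ.comp T) (η.compContinuousLinearMap T) := by
  ext v
  simp only [compContinuousLinearMap_apply, wedgeOne_apply, ContinuousLinearMap.comp_apply, comp_apply]
  rfl

/-- **Pull-back of monomials**: `T^*(θ_{w 0} ∧ ⋯ ∧ c) = (θ ∘ T)_{w 0} ∧ ⋯ ∧ T^*c`. [cite: Warner1983, 2.22] -/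
theorem wedgeWord_compContinuousLinearMap {σ : Type*} (θ : σ → (V →L[ℝ] 𝕜')) (c : V [⋀^Fin 0]→L[ℝ] F)
    (T : W →L[ℝ] V) :
    ∀ (k : ℕ) (w : Fin k → σ), (wedgeWord θ c k w).compContinuousLinearMap T =
      wedgeWord (fun i ↦ (θ i).comp T) (c.compContinuousLinearMap T) k w
  | 0, _ => rfl
  | k + 1, w => by
    rw [wedgeWord_succ, wedgeWord_succ, wedgeOne_compContinuousLinearMap',
      wedgeWord_compContinuousLinearMap θ c T k (Fin.tail w)]

/-- Pull-back of a constant `0`-form is the same constant. [folklore] -/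
theorem constOfIsEmpty_compContinuousLinearMap (a : F) (T : W →L[ℝ] V) :
    (ContinuousAlternatingMap.constOfIsEmpty ℝ V (Fin 0) a).compContinuousLinearMap T =
      ContinuousAlternatingMap.constOfIsEmpty ℝ W (Fin 0) a := rfl

end Pullback

end Literature.LinearAlgebra.Alternating

namespace Literature.Geometry.Kaehler

namespace ComplexTorus

variable {ι : Type*} {E : Type*} [NormedAddCommGroup E] [NormedSpace ℂ E] (Φ : (ι → ℝ) ≃L[ℝ] E)

/-! ### Lattice monomials -/

/-- **The lattice monomial** `dx_{w 0} ∧ ⋯ ∧ dx_{w (k-1)} ∧ 1 ∈ Alt^k_ℝ(E; ℂ)` of a word in the lattice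
coordinates (`frameWord` of the coordinate frame `coord Φ`). [cite: LangeBirkenhake1992, §1.1.4 Prop. 1.1.20] -/
def latMonomial (k : ℕ) (w : Fin k → ι) : E [⋀^Fin k]→L[ℝ] ℂ := frameWord ℂ (coord Φ) k w

/-- Unfolding of `latMonomial`. [folklore] -/
theorem latMonomial_eq (k : ℕ) (w : Fin k → ι) :
    latMonomial Φ k w = wedgeWord (fun a ↦ (coord Φ a).smulRight (1 : ℂ))
      (ContinuousAlternatingMap.constOfIsEmpty ℝ E (Fin 0) (1 : ℂ)) k w := rfl

/-- The coordinate frame is dual to the lattice basis: `xₐ(Φ e_b) = δ_{ab}`. [cite: LangeBirkenhake1992, §1.1.4 Prop. 1.1.20] -/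
theorem coord_dual [DecidableEq ι] (a b : ι) :
    coord Φ a (Φ (Pi.single b 1)) = if a = b then 1 else 0 := coord_apply_single Φ a b

/-- The coordinate frame is a dual frame: `Σₐ xₐ(·) Φ eₐ = id`. [cite: LangeBirkenhake1992, §1.1.4] -/
theorem sum_coord_smulRight_single [Fintype ι] [DecidableEq ι] :
    ∑ a, (coord Φ a).smulRight (Φ (Pi.single a 1)) = ContinuousLinearMap.id ℝ E := by
  refine ContinuousLinearMap.ext fun z ↦ ?_
  rw [_root_.sum_apply, ContinuousLinearMap.coe_id', id_eq]
  simp only [ContinuousLinearMap.smulRight_apply, coord_apply, ← map_smul]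
  rw [← _root_.map_sum]
  conv_rhs => rw [← Φ.apply_symm_apply z]
  congr 1
  conv_rhs => rw [← Finset.univ_sum_single (Φ.symm z)]
  refine Finset.sum_congr rfl fun q _ ↦ ?_
  rw [← Pi.single_smul, smul_eq_mul, mul_one]

include Φ in
/-- **The basis of increasing lattice monomials** of `Alt^k_ℝ(E; ℂ)` (Lange–Birkenhake (1992),
Prop. 1.1.20, pointwise: "`dx_{i₁} ∧ ⋯ ∧ dx_{iₙ}`, `i₁ < ⋯ < iₙ`, form a basis").
[cite: LangeBirkenhake1992, §1.1.4 Prop. 1.1.20] -/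
def latMonomialBasis [Fintype ι] [LinearOrder ι] (k : ℕ) :
    Module.Basis {w : Fin k → ι // StrictMono w} ℂ (E [⋀^Fin k]→L[ℝ] ℂ) :=
  frameWordBasis (𝕜' := ℂ) (coord Φ) (fun a ↦ Φ (Pi.single a 1)) (coord_dual Φ)
    (sum_coord_smulRight_single Φ) k

/-- The basis vectors are the lattice monomials. [cite: LangeBirkenhake1992, §1.1.4 Prop. 1.1.20] -/
theorem latMonomialBasis_apply [Fintype ι] [LinearOrder ι] (k : ℕ) (w : {w : Fin k → ι // StrictMono w}) :
    latMonomialBasis Φ k w = latMonomial Φ k w.1 :=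
  frameWordBasis_apply _ _ _ _ k w

include Φ in
/-- **`dim_ℂ Alt^k_ℝ(E; ℂ) = #{increasing words} = C(2g, k)`** (Lange–Birkenhake (1992),
Exercise 1.1.6 (8): `rank Hᵏ(X, ℤ) = C(2g, k)`). [cite: LangeBirkenhake1992, §1.1.3 Exercise 1.1.6 (8)] -/
theorem finrank_alt_eq_card_strictMono [Fintype ι] [LinearOrder ι] (k : ℕ) :
    Module.finrank ℂ (E [⋀^Fin k]→L[ℝ] ℂ) = Fintype.card {w : Fin k → ι // StrictMono w} :=
  finrank_eq_card_strictMono (𝕜' := ℂ) (coord Φ) (fun a ↦ Φ (Pi.single a 1)) (coord_dual Φ)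
    (sum_coord_smulRight_single Φ) k

/-! ### The action of homomorphisms -/

variable [Fintype ι]

/-- **Lattice coordinates transform by the rational representation** (continuous-linear-map form of
`coord_realRep`): `xₐ ∘ ρ(A) = Σ_c A_{ac} x_c`. [cite: LangeBirkenhake1992, §1.1.2] -/
theorem coord_smulRight_comp_realRep (A : Matrix ι ι ℤ) (a : ι) :
    ((coord Φ a).smulRight (1 : ℂ)).comp (realRep Φ Φ A) =
      ∑ c, ((A a c : ℤ) : ℂ) • (coord Φ c).smulRight (1 : ℂ) := by
  ext v
  rw [ContinuousLinearMap.comp_apply, ContinuousLinearMap.smulRight_apply, coord_realRep,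
    _root_.sum_apply, Finset.sum_smul]
  refine Finset.sum_congr rfl fun c _ ↦ ?_
  simp only [_root_.smul_apply, ContinuousLinearMap.smulRight_apply, Complex.real_smul, mul_one,
    smul_eq_mul]
  push_cast
  ring

/-- **Homomorphisms act on the lattice monomials by `⋀ᵏ` of the rational representation**:
`dx_w ∘ ρ(A) = Σ_u (∏ᵢ A_{w i, u i}) dx_u`, the sum over all words `u : Fin k → ι`.
[cite: LangeBirkenhake1992, §1.1.2 and §1.1.3 Lemma 1.1.17] -/
theorem latMonomial_comp_realRep (A : Matrix ι ι ℤ) (k : ℕ) (w : Fin k → ι) :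
    (latMonomial Φ k w).compContinuousLinearMap (realRep Φ Φ A) =
      ∑ u : Fin k → ι, ((∏ i, A (w i) (u i) : ℤ) : ℂ) • latMonomial Φ k u := by
  rw [latMonomial_eq, wedgeWord_compContinuousLinearMap, constOfIsEmpty_compContinuousLinearMap,
    wedgeWord_eq_wedgeSeq]
  have hl : ((fun a ↦ ((coord Φ a).smulRight (1 : ℂ)).comp (realRep Φ Φ A)) ∘ w) =
      fun i ↦ ∑ c, ((A (w i) c : ℤ) : ℂ) • (coord Φ c).smulRight (1 : ℂ) := by
    funext i
    exact coord_smulRight_comp_realRep Φ A (w i)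
  rw [hl, wedgeSeq_sum_smul]
  refine Finset.sum_congr rfl fun u _ ↦ ?_
  rw [Int.cast_prod, latMonomial_eq, wedgeWord_eq_wedgeSeq]
  rfl

/-- **The rational structure is stable under homomorphisms**: `dx_w ∘ ρ(A)` lies in the `ℤ`-module
(hence the `ℚ`-span) generated by the lattice monomials. [cite: LangeBirkenhake1992, §1.1.2 and §1.1.4] -/
theorem latMonomial_comp_realRep_mem_span (A : Matrix ι ι ℤ) (k : ℕ) (w : Fin k → ι) :
    (latMonomial Φ k w).compContinuousLinearMap (realRep Φ Φ A) ∈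
      Submodule.span ℤ (Set.range (latMonomial Φ k)) := by
  rw [latMonomial_comp_realRep]
  refine Submodule.sum_mem _ fun u _ ↦ ?_
  have hz : (((∏ i, A (w i) (u i) : ℤ) : ℂ) • latMonomial Φ k u) =
      (∏ i, A (w i) (u i) : ℤ) • latMonomial Φ k u := by
    module
  rw [hz]
  exact zsmul_mem (Submodule.subset_span (s := Set.range (latMonomial Φ k)) ⟨u, rfl⟩ :
    latMonomial Φ k u ∈ Submodule.span ℤ (Set.range (latMonomial Φ k))) _

/-- **Homomorphisms act on the complex classes of invariant forms through the analytic
representation**: `(mapMatrix A)^*[c] = [c ∘ ρ(A)]` in `H^k_dR(X; ℂ)` (complex-coefficient form of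
`map_constClass_mapMatrix`, for endomorphisms). [cite: LangeBirkenhake1992, §1.1.4] -/
theorem cmap_cconstClass_mapMatrix (A : Matrix ι ι ℤ) {k : ℕ} (c : E [⋀^Fin k]→L[ℝ] ℂ) :
    complexDeRhamCohomology.map E (contMDiff_real_mapMatrix (Φ := Φ) (Φ' := Φ) (n := ∞) A) k
        (cconstClass Φ c) =
      cconstClass Φ (c.compContinuousLinearMap (realRep Φ Φ A)) := by
  rw [cconstClass_apply, complexDeRhamCohomology.map_mk, cconstClass_apply]
  congr 1
  exact Subtype.ext (pullback_constForm_mapMatrix (Φ := Φ) (Φ' := Φ) A c)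

/-- **Homomorphisms act on the classes of the lattice monomials by `⋀ᵏ` of the rational
representation**: `(mapMatrix A)^*[dx_w] = Σ_u (∏ᵢ A_{w i, u i}) [dx_u]`.
[cite: LangeBirkenhake1992, §1.1.2 and §1.1.3 Lemma 1.1.17] -/
theorem cmap_cconstClass_latMonomial (A : Matrix ι ι ℤ) (k : ℕ) (w : Fin k → ι) :
    complexDeRhamCohomology.map E (contMDiff_real_mapMatrix (Φ := Φ) (Φ' := Φ) (n := ∞) A) k
        (cconstClass Φ (latMonomial Φ k w)) =
      ∑ u : Fin k → ι, ((∏ i, A (w i) (u i) : ℤ) : ℂ) • cconstClass Φ (latMonomial Φ k u) := by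
  rw [cmap_cconstClass_mapMatrix, latMonomial_comp_realRep Φ A k w, _root_.map_sum]
  simp only [map_smul]

end ComplexTorus

end Literature.Geometry.Kaehler

end
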